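import Mathlib
import Literature.NumberTheory.Sieve.BatemanHorn
import Summits.Parity.BatemanHorn.Theorems.SystemLSDRealSegment.Negative.OmegaWide

/-!
# Crux triage r1·k2 (stmt-Parity-9770, `SelbergDelangeRigidity.LSDRealSegment`):
# two typed stubs of the idea cards are FALSE AS TYPED

* `TwinFractionBound θ` — card `twin-three-regime-map`, first lemma (b) (`Ideator3Sketch.lean`): the saving
  exponent and the frequency-range exponent share ONE `ε` quantified `∀ ε > 0`, with the bound `x^{1-ε}`
  DEcreasing in `ε`; at `ε = 2` the single term `m = n = 1` already violates it.  Repair: `∃ ε > 0, …`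
  (or `∀ ε ∈ (0, ε₀)`), which is the statement the card's regime (C) actually consumes.
* `UncappedShortIntervalBound` — card `shared-kernel-uncapped-transfer`, stub (U) (`Ideator1Sketch.lean`):
  for `f = X`, `y = 3/2`, `ε = 1/2` the single prime power `n = 4^b` in the window `(4^b - 1, 4^b - 1 + 2^b]`
  weighs `y^{Ω(4^b)} = (9/4)^b`, which beats `C · 2^b · (log x)^{1/2}`.  In general the un-capped tilt `y^Ω`
  has NO short-interval upper bound below `h = x^{log₂ y}` (`log₂(7/4) = 0.807`); repair: `h ≥ x^{1-δ}` with
  `δ < 1 - log₂ y`, or long sums `h = x` (which is all the sibling skeleton's `TiltedTails` uses).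
The defs are VERBATIM copies (the `Cruxes/…/Ideator*Sketch` modules are not built on the farm).
-/

open Filter Finset Polynomial
open scoped BigOperators Topology Classical ArithmeticFunction.omega ArithmeticFunction.Omega

namespace Summit.Parity.BatemanHorn.Cruxes.LSDRealSegment.TriageR1K2

noncomputable section

/-! ## 1. `TwinFractionBound` (verbatim copy of `Ideator3.TwinFractionBound`) -/

/-- VERBATIM copy of `Summit.Parity.BatemanHorn.Cruxes.LSDRealSegment.Ideator3.TwinFractionBound`. -/
def TwinFractionBound (θ : ℝ) : Prop :=
  ∀ ε : ℝ, 0 < ε → ∃ x₀ : ℝ, ∀ x : ℝ, x₀ ≤ x → ∀ M N : ℝ, 1 ≤ M → 1 ≤ N →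
    x ^ θ / 4 ≤ M * N → M * N ≤ x ^ θ → M ≤ x ^ ((2 * θ - 1) / 2) → N ≤ x ^ ((2 * θ - 1) / 2) →
    ∀ h : ℤ, h ≠ 0 → |(h : ℝ)| ≤ x ^ (θ - 1 + ε) → ∀ α β : ℕ → ℂ,
    (∀ m, ‖α m‖ ≤ 1) → (∀ n, ‖β n‖ ≤ 1) →
      ‖∑ m ∈ Finset.Icc 1 ⌊2 * M⌋₊, ∑ n ∈ Finset.Icc 1 ⌊2 * N⌋₊,
          if Nat.Coprime m n then
            α m * β n * Complex.exp (2 * Real.pi * Complex.I *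
              ((2 * h : ℂ) * ((((m : ZMod n)⁻¹).val : ℕ) : ℂ) / (n : ℂ)))
          else 0‖ ≤ x ^ (1 - ε)

/-- `TwinFractionBound θ` is false for every `θ ≥ 1` (in particular on the card's range `1 < θ ≤ 4/3`):
witness `ε = 2`, `x = max x₀ 2`, `M = N = x^{θ/2}`, `h = 1`, `α = β = 𝟙_{·=1}`, sum `= 1 > x⁻¹`. [folklore] -/
theorem not_twinFractionBound {θ : ℝ} (hθ : 1 ≤ θ) : ¬ TwinFractionBound θ := by
  intro H
  obtain ⟨x₀, hx₀⟩ := H 2 two_pos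
  set x : ℝ := max x₀ 2 with hx
  have hxx₀ : x₀ ≤ x := le_max_left _ _
  have hx2 : (2 : ℝ) ≤ x := le_max_right _ _
  have hx1 : (1 : ℝ) ≤ x := by linarith
  have hx0 : (0 : ℝ) < x := by linarith
  set M : ℝ := x ^ (θ / 2) with hM
  have hM1 : 1 ≤ M := Real.one_le_rpow hx1 (by linarith)
  have hMM : M * M = x ^ θ := by
    rw [hM, ← Real.rpow_add hx0]; ring_nf
  have h1 : x ^ θ / 4 ≤ M * M := by
    rw [hMM]; linarith [Real.rpow_nonneg hx0.le θ]
  have h2 : M * M ≤ x ^ θ := hMM.le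
  have h3 : M ≤ x ^ ((2 * θ - 1) / 2) := Real.rpow_le_rpow_of_exponent_le hx1 (by linarith)
  let α : ℕ → ℂ := fun m => if m = 1 then 1 else 0
  have hα : ∀ m, ‖α m‖ ≤ 1 := by
    intro m; by_cases hm : m = 1 <;> simp [α, hm]
  have hh : |((1 : ℤ) : ℝ)| ≤ x ^ (θ - 1 + 2) := by
    simpa using Real.one_le_rpow hx1 (by linarith : (0 : ℝ) ≤ θ - 1 + 2)
  have key := hx₀ x hxx₀ M M hM1 hM1 h1 h2 h3 h3 1 one_ne_zero hh α α hα hα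
  have hmem : 1 ∈ Finset.Icc 1 ⌊2 * M⌋₊ := by
    simp only [Finset.mem_Icc, le_refl, true_and]
    exact Nat.le_floor (by push_cast; linarith)
  have hsum : (∑ m ∈ Finset.Icc 1 ⌊2 * M⌋₊, ∑ n ∈ Finset.Icc 1 ⌊2 * M⌋₊,
      if Nat.Coprime m n then α m * α n * Complex.exp (2 * Real.pi * Complex.I *
        ((2 * (1 : ℤ) : ℂ) * ((((m : ZMod n)⁻¹).val : ℕ) : ℂ) / (n : ℂ))) else 0) = 1 := by
    rw [Finset.sum_eq_single_of_mem 1 hmem, Finset.sum_eq_single_of_mem 1 hmem]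
    · simp [α, ZMod.inv_zero]
    · intro n _ hn
      simp [α, hn]
    · intro m _ hm
      refine Finset.sum_eq_zero fun n _ => ?_
      simp [α, hm]
  rw [hsum] at key
  have hlt : x ^ ((1 : ℝ) - 2) < 1 := by
    rw [show (1 : ℝ) - 2 = -1 by norm_num, Real.rpow_neg_one]
    have : x⁻¹ ≤ 2⁻¹ := by
      rw [inv_le_inv₀ hx0 two_pos]; exact hx2
    linarith
  simp only [norm_one] at key
  linarith

/-! ## 2. `UncappedShortIntervalBound` (verbatim copies of `Ideator1.OmegaF`, `Ideator1.UncappedShortIntervalBound`) -/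

/-- VERBATIM copy of `Ideator1.OmegaF`: `Ω_f(n) = Σᵢ Ω(fᵢ(n))`. -/
def OmegaF {k : ℕ} (f : Fin k → ℤ[X]) (n : ℕ) : ℕ := ∑ i, Ω (((f i).eval (n : ℤ)).toNat)

/-- VERBATIM copy of `Ideator1.UncappedShortIntervalBound`. -/
def UncappedShortIntervalBound : Prop :=
  ∀ (k : ℕ) (f : Fin k → ℤ[X]), Literature.NumberTheory.Sieve.IsBatemanHornSystem f →
    ∀ y : ℝ, 1 ≤ y → y < 2 → ∀ ε : ℝ, 0 < ε → ∃ C : ℝ, ∀ᶠ x : ℕ in atTop, ∀ h : ℕ,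
      (x : ℝ) ^ ε ≤ h → h ≤ x →
        ∑ n ∈ Ioc x (x + h), y ^ OmegaF f n ≤ C * h * (Real.log x) ^ ((k : ℝ) * (y - 1))

/-- For `f = X` the statistic is `Ω(n)`. [folklore] -/
theorem omegaF_X (n : ℕ) : OmegaF ![X] n = Ω n := by
  simp [OmegaF]

/-- `Ω(4^b) = 2b`. [folklore] -/
theorem cardFactors_four_pow (b : ℕ) : Ω (4 ^ b) = 2 * b := by
  rw [show (4 : ℕ) ^ b = 2 ^ (2 * b) by rw [pow_mul]; norm_num]
  exact ArithmeticFunction.cardFactors_apply_prime_pow Nat.prime_two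

/-- `UncappedShortIntervalBound` is false: `k = 1`, `f = X`, `y = 3/2`, `ε = 1/2`, `x = 4^b - 1`, `h = 2^b`;
the single term `n = 4^b` gives `(9/4)^b ≤ C · 2^b · (log x)^{1/2} ≤ 4 C b 2^b`, i.e. `(9/8)^b ≤ 4 C b`,
impossible for large `b`. [folklore] -/
theorem not_uncappedShortIntervalBound : ¬ UncappedShortIntervalBound := by
  intro H
  obtain ⟨C, hC⟩ := H 1 ![X]
    Summit.Parity.BatemanHorn.Theorems.SystemLSDRealSegment.Negative.isBatemanHornSystem_X
    (3 / 2) (by norm_num) (by norm_num) (1 / 2) (by norm_num)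
  rw [Filter.eventually_atTop] at hC
  obtain ⟨N, hN⟩ := hC
  -- growth: b · (8/9)^b → 0
  have ht := tendsto_self_mul_const_pow_of_lt_one (by norm_num : (0 : ℝ) ≤ 8 / 9)
    (by norm_num : (8 : ℝ) / 9 < 1)
  have hev : ∀ᶠ b : ℕ in atTop, (b : ℝ) * (8 / 9) ^ b < 1 / (4 * |C| + 1) :=
    ht.eventually (gt_mem_nhds (by positivity))
  obtain ⟨b, hb1, hbN, hbsmall⟩ : ∃ b : ℕ, 1 ≤ b ∧ N ≤ b ∧ (b : ℝ) * (8 / 9) ^ b < 1 / (4 * |C| + 1) := by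
    obtain ⟨b, hb⟩ := ((eventually_ge_atTop 1).and ((eventually_ge_atTop N).and hev)).exists
    exact ⟨b, hb.1, hb.2.1, hb.2.2⟩
  -- the window
  have h4pos : 1 ≤ 4 ^ b := Nat.one_le_pow _ _ (by norm_num)
  have h2b : 2 ≤ 2 ^ b := by
    calc (2 : ℕ) = 2 ^ 1 := by norm_num
      _ ≤ 2 ^ b := Nat.pow_le_pow_right (by norm_num) hb1
  have h42 : (4 : ℕ) ^ b = 2 ^ b * 2 ^ b := by rw [← mul_pow]; norm_num
  set x : ℕ := 4 ^ b - 1 with hx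
  have hx1 : x + 1 = 4 ^ b := Nat.sub_add_cancel h4pos
  have hNx : N ≤ x := by
    have : b + 1 ≤ 4 ^ b := by
      calc b + 1 ≤ 2 ^ b := Nat.succ_le_of_lt Nat.lt_two_pow_self
        _ ≤ 2 ^ b * 2 ^ b := Nat.le_mul_of_pos_right _ (by positivity)
        _ = 4 ^ b := h42.symm
    omega
  have hhx : 2 ^ b ≤ x := by
    have : 2 ^ b + 1 ≤ 4 ^ b := by rw [h42]; nlinarith
    omega
  have hxR : ((x : ℕ) : ℝ) = (4 : ℝ) ^ b - 1 := by
    rw [hx, Nat.cast_sub h4pos]; push_cast; ring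
  have hxpos : (0 : ℝ) < (x : ℝ) := by
    have : (1 : ℝ) ≤ (2 : ℝ) ^ b := one_le_pow₀ (by norm_num)
    have h2x : ((2 ^ b : ℕ) : ℝ) ≤ x := by exact_mod_cast hhx
    push_cast at h2x; linarith
  have hsqrt : ((x : ℕ) : ℝ) ^ ((1 : ℝ) / 2) ≤ ((2 ^ b : ℕ) : ℝ) := by
    rw [← Real.sqrt_eq_rpow, hxR]
    push_cast
    calc Real.sqrt ((4 : ℝ) ^ b - 1) ≤ Real.sqrt ((4 : ℝ) ^ b) := Real.sqrt_le_sqrt (by linarith)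
      _ = (2 : ℝ) ^ b := by
        rw [show (4 : ℝ) ^ b = ((2 : ℝ) ^ b) ^ 2 by rw [← pow_mul, mul_comm, pow_mul]; norm_num]
        exact Real.sqrt_sq (by positivity)
  have key := hN x hNx (2 ^ b) hsqrt hhx
  -- lower bound: the single term n = 4^b
  have hmem : 4 ^ b ∈ Ioc x (x + 2 ^ b) := by
    rw [Finset.mem_Ioc]; omega
  have hterm : ((3 : ℝ) / 2) ^ OmegaF ![X] (4 ^ b) = (9 / 4 : ℝ) ^ b := by
    rw [omegaF_X, cardFactors_four_pow, pow_mul]; norm_num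
  have hlow : (9 / 4 : ℝ) ^ b ≤ ∑ n ∈ Ioc x (x + 2 ^ b), ((3 : ℝ) / 2) ^ OmegaF ![X] n := by
    rw [← hterm]
    exact Finset.single_le_sum (f := fun n => ((3 : ℝ) / 2) ^ OmegaF ![X] n) (fun n _ => by positivity) hmem
  -- upper bound: C * 2^b * (log x)^{1/2} ≤ |C| * 2^b * 4 b
  have hexp : ((1 : ℕ) : ℝ) * (3 / 2 - 1) = (1 : ℝ) / 2 := by norm_num
  rw [hexp] at key
  have hlog0 : 0 ≤ Real.log x := Real.log_nonneg (by
    have : ((2 ^ b : ℕ) : ℝ) ≤ x := by exact_mod_cast hhx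
    have h1 : (1 : ℝ) ≤ (2 : ℝ) ^ b := one_le_pow₀ (by norm_num)
    push_cast at this; linarith)
  have hlogle : Real.log x ≤ 3 * b := by
    calc Real.log x ≤ Real.log ((4 : ℝ) ^ b) := by
          apply Real.log_le_log hxpos; rw [hxR]; linarith
      _ = b * Real.log 4 := by rw [Real.log_pow]
      _ ≤ b * 3 := by
          apply mul_le_mul_of_nonneg_left _ (by positivity)
          have := Real.log_le_sub_one_of_pos (by norm_num : (0 : ℝ) < 4)
          linarith
      _ = 3 * b := by ring
  have hb1R : (1 : ℝ) ≤ b := by exact_mod_cast hb1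
  have hsq : (Real.log x) ^ ((1 : ℝ) / 2) ≤ 4 * b := by
    rw [← Real.sqrt_eq_rpow, Real.sqrt_le_iff]
    constructor
    · positivity
    · nlinarith
  have hup : C * ((2 ^ b : ℕ) : ℝ) * (Real.log x) ^ ((1 : ℝ) / 2) ≤ |C| * (2 : ℝ) ^ b * (4 * b) := by
    push_cast
    calc C * (2 : ℝ) ^ b * (Real.log x) ^ ((1 : ℝ) / 2)
        ≤ |C| * (2 : ℝ) ^ b * (Real.log x) ^ ((1 : ℝ) / 2) := by
          apply mul_le_mul_of_nonneg_right _ (by positivity)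
          exact mul_le_mul_of_nonneg_right (le_abs_self C) (by positivity)
      _ ≤ |C| * (2 : ℝ) ^ b * (4 * b) := by
          apply mul_le_mul_of_nonneg_left hsq (by positivity)
  -- combine: (9/4)^b ≤ 4 |C| b 2^b, i.e. (9/8)^b ≤ 4 |C| b; but b (8/9)^b < 1/(4|C|+1)
  have hmain : (9 / 4 : ℝ) ^ b ≤ |C| * (2 : ℝ) ^ b * (4 * b) := hlow.trans (key.trans hup)
  have h98 : (9 / 8 : ℝ) ^ b ≤ 4 * |C| * b := by
    have h2pos : (0 : ℝ) < (2 : ℝ) ^ b := by positivity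
    have : (9 / 4 : ℝ) ^ b = (9 / 8 : ℝ) ^ b * (2 : ℝ) ^ b := by rw [← mul_pow]; norm_num
    rw [this] at hmain
    nlinarith
  have hprod : ((9 : ℝ) / 8) ^ b * ((8 : ℝ) / 9) ^ b = 1 := by rw [← mul_pow]; norm_num
  have hpos98 : (0 : ℝ) < (9 / 8 : ℝ) ^ b := by positivity
  -- from hbsmall: b (8/9)^b (4|C|+1) < 1, hence (4|C|+1) b < (9/8)^b
  have hC1 : (0 : ℝ) < 4 * |C| + 1 := by positivity
  have hlt : (4 * |C| + 1) * b < (9 / 8 : ℝ) ^ b := by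
    have h' : (b : ℝ) * (8 / 9) ^ b * (4 * |C| + 1) < 1 := by
      rwa [lt_div_iff₀ hC1] at hbsmall
    have : (4 * |C| + 1) * (b : ℝ) = ((b : ℝ) * (8 / 9) ^ b * (4 * |C| + 1)) * (9 / 8 : ℝ) ^ b := by
      have := hprod; field_simp; nlinarith [this]
    rw [this]
    calc ((b : ℝ) * (8 / 9) ^ b * (4 * |C| + 1)) * (9 / 8 : ℝ) ^ b < 1 * (9 / 8 : ℝ) ^ b :=
          mul_lt_mul_of_pos_right h' hpos98
      _ = (9 / 8 : ℝ) ^ b := one_mul _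
  nlinarith

end

end Summit.Parity.BatemanHorn.Cruxes.LSDRealSegment.TriageR1K2
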